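import Mathlib
import Summits.KontsevichZagierPeriods.KontsevichZagierPeriods.Theorems.SoloInformedPellAbelCircForm
import HarnessLib
import HarnessLib.Audit

/-!
# The quarter-turn Abel theorem for the third kind, I: the form, its potentials, boundary values

Companion of `SoloInformedPellAbelCircForm` (THEOREM XXXI, total turning `π`) for the packets whose
Pell–Abel unit is a **quarter turn**: `h = C·W + i·B` (`W = √Δ`, `Δ = (1−t²)(1−mt²)`, `κ = 1/W`)
with `|h|² = C²Δ + B² = R(1−nt²)`, `B(0) = 0 < C(0)` and `B > 0` on `(0,1]`, so that `h(0) > 0`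
and `h(1) = iB(1)` lies on the positive imaginary axis (`W(1) = 0`): total turning `π/2` (the
order-4 circular and negative packets of the Kummer family, COR XXIX.10).  The proof in `P` is the
one of THEOREM XXXI with the MODEL CURVE `(1+it)²`: the straight-line homotopy
`γ_v = (1−v)(1+it)² + v·h` never vanishes on `[0,1]²` (its imaginary part is positive for `t > 0`),
the angular form pulled back to the square is `ω = ∂_t ϑ = ∂_v Θ` with `ϑ(0,v) = ϑ(1,v) = 0`,
`Θ(t,0) = 2/(1+t²)` and `Θ(t,1) = (q₀+q₂t²)κ/(2(1−nt²))` (THEOREM XXXI′, in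
`SoloInformedPellAbelQuarterLaw`).  This file: the structure, the functions, `|γ|² > 0`, the two
derivative identities, the boundary values, fibrewise continuity.  No sign condition on `n < 1`
(circular `m < n < 1` and negative `n < 0` packets alike) and none on `C` beyond `C(0) > 0`.
-/

noncomputable section

open MeasureTheory Set Filter
open scoped Classical

open Literature.NumberTheory.Transcendental Literature.NumberTheory.Transcendental.KZ
open Literature.ModelTheory.ExponentialFields

namespace Summit.KontsevichZagierPeriods.KontsevichZagierPeriods.Theorems

/-- A **quarter-turn Pell–Abel datum**: modulus `m ∈ (0,1)`, parameter `n < 1`, the unit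
`C√Δ + iB` with `C²Δ + B² = R(1−nt²)`, its logarithmic derivative `(q₀ + q₂t²)R`, the sign
pattern `B(0) = 0 < C(0)`, `B > 0` on `(0,1]`, the residue condition, and the (semi)algebraicity
of all coefficients. [Abel 1826; this work] -/
structure SoloInformedPellAbelQuarter where
  /-- the modulus `m` -/
  m : ℝ
  /-- the parameter `n` of the third kind -/
  n : ℝ
  /-- constant coefficient of the residue polynomial `q` -/
  q₀ : ℝ
  /-- quadratic coefficient of the residue polynomial `q` -/
  q₂ : ℝ
  /-- the polynomial `C` (coefficient of `√Δ` in the real part) -/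
  C : ℝ → ℝ
  /-- its derivative -/
  C' : ℝ → ℝ
  /-- the polynomial `B` (the imaginary part) -/
  B : ℝ → ℝ
  /-- its derivative -/
  B' : ℝ → ℝ
  /-- the cofactor `R` of the norm -/
  R : ℝ → ℝ
  m_mem : m ∈ Ioo (0:ℝ) 1
  n_lt : n < 1
  m_isAlgebraic : IsAlgebraic ℚ m
  n_isAlgebraic : IsAlgebraic ℚ n
  q₀_isAlgebraic : IsAlgebraic ℚ q₀
  q₂_isAlgebraic : IsAlgebraic ℚ q₂
  hasDerivAt_C : ∀ t, HasDerivAt C (C' t) t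
  hasDerivAt_B : ∀ t, HasDerivAt B (B' t) t
  continuous_C' : Continuous C'
  continuous_B' : Continuous B'
  norm : ∀ t, C t ^ 2 * ((1 - t ^ 2) * (1 - m * t ^ 2)) + B t ^ 2 = R t * (1 - n * t ^ 2)
  num : ∀ t, 2 * (C t * B' t - C' t * B t) * ((1 - t ^ 2) * (1 - m * t ^ 2)) -
      C t * B t * (-(2 * t) * (1 - m * t ^ 2) + (1 - t ^ 2) * (-(m * (2 * t)))) =
    (q₀ + q₂ * t ^ 2) * R t
  R_pos : ∀ t, t ^ 2 ≤ 1 → 0 < R t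
  C_zero : 0 < C 0
  B_zero : B 0 = 0
  B_pos : ∀ t ∈ Ioc (0:ℝ) 1, 0 < B t
  res : q₂ + n * q₀ ≠ 0
  sa_C : ∀ ⦃S : Set (Fin 2 → ℝ)⦄, IsSemialgebraic ℚ S → ∀ i : Fin 2,
    IsSemialgebraicFunOn ℚ S (fun w => C (w i))
  sa_C' : ∀ ⦃S : Set (Fin 2 → ℝ)⦄, IsSemialgebraic ℚ S → ∀ i : Fin 2,
    IsSemialgebraicFunOn ℚ S (fun w => C' (w i))
  sa_B : ∀ ⦃S : Set (Fin 2 → ℝ)⦄, IsSemialgebraic ℚ S → ∀ i : Fin 2,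
    IsSemialgebraicFunOn ℚ S (fun w => B (w i))
  sa_B' : ∀ ⦃S : Set (Fin 2 → ℝ)⦄, IsSemialgebraic ℚ S → ∀ i : Fin 2,
    IsSemialgebraicFunOn ℚ S (fun w => B' (w i))

namespace SoloInformedPellAbelQuarter

variable (P : SoloInformedPellAbelQuarter)

/-! ### The model curve `(1+it)²`, the homotopy, the 2-form and its potentials -/

/-- `a₂ = Re (1+it)²`. [this work] -/
def a₂ (t : ℝ) : ℝ := 1 - t ^ 2

/-- `a₂′`. [this work] -/
def a₂' (t : ℝ) : ℝ := -(2 * t)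

/-- `b₂ = Im (1+it)²`. [this work] -/
def b₂ (t : ℝ) : ℝ := 2 * t

/-- `b₂′`. [this work] -/
def b₂' (_t : ℝ) : ℝ := 2

/-- `Y = C·W`, the real part of the unit. [this work] -/
def Y (t : ℝ) : ℝ := P.C t * soloInformedT4W P.m t

/-- `W′/κ = −t((1−mt²) + m(1−t²))`. [this work] -/
def Wd (t : ℝ) : ℝ := -(t * ((1 - P.m * t ^ 2) + P.m * (1 - t ^ 2)))

/-- `Y′` with the kernel `κ` replaced by a formal letter `k`. [this work] -/
def Yd (t k : ℝ) : ℝ := P.C' t * soloInformedT4W P.m t + P.C t * (P.Wd t * k)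

/-- Real part `(1−v)a₂ + vY` of the homotopy. [this work] -/
def re (t v : ℝ) : ℝ := (1 - v) * a₂ t + v * P.Y t

/-- `∂_t` of the real part (kernel letter `k`). [this work] -/
def dre (t v k : ℝ) : ℝ := (1 - v) * a₂' t + v * P.Yd t k

/-- Imaginary part `(1−v)b₂ + vB` of the homotopy. [this work] -/
def im (t v : ℝ) : ℝ := (1 - v) * b₂ t + v * P.B t

/-- `∂_t` of the imaginary part. [this work] -/
def dim (t v : ℝ) : ℝ := (1 - v) * b₂' t + v * P.B' t

/-- `|γ_v(t)|²`. [this work] -/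
def Dn (t v : ℝ) : ℝ := P.re t v * P.re t v + P.im t v * P.im t v

/-- `Re γ · ∂_t Im γ − Im γ · ∂_t Re γ` (so `Θ = Nm/Dn = ∂_t arg γ_v`). [this work] -/
def Nm (t v k : ℝ) : ℝ := P.re t v * P.dim t v - P.im t v * P.dre t v k

/-- `∂_v Nm`. [this work] -/
def Nmv (t v k : ℝ) : ℝ :=
  (P.Y t - a₂ t) * P.dim t v + P.re t v * (P.B' t - b₂' t) -
    ((P.B t - b₂ t) * P.dre t v k + P.im t v * (P.Yd t k - a₂' t))

/-- `∂_v Dn`. [this work] -/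
def Dnv (t v : ℝ) : ℝ := 2 * P.re t v * (P.Y t - a₂ t) + 2 * P.im t v * (P.B t - b₂ t)

/-- `En = Nm_v·Dn − Nm·Dn_v` (so `ω = En/Dn²`). [this work] -/
def En (t v k : ℝ) : ℝ := P.Nmv t v k * P.Dn t v - P.Nm t v k * P.Dnv t v

/-- The kernel `κ(t) = 1/√((1−t²)(1−mt²))`. [folklore] -/
def kq (t : ℝ) : ℝ := (√(1 - t ^ 2))⁻¹ * (√(1 - P.m * t ^ 2))⁻¹

/-- The deformation potential `Θ(t,v) = ∂_t arg γ_v(t)`. [this work] -/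
def Th (t v : ℝ) : ℝ := P.Nm t v (P.kq t) / P.Dn t v

/-- The 2-form `ω = ∂_v Θ = ∂_t ϑ` off the face `t = 1`. [this work] -/
def omCore (t v : ℝ) : ℝ := P.En t v (P.kq t) / P.Dn t v ^ 2

/-- The 2-form, glued by `0` on the null face `t = 1`. [this work] -/
def om (t v : ℝ) : ℝ := if t < 1 then P.omCore t v else 0

/-- The kill potential `ϑ(t,v) = ∂_v arg γ_v(t) = (a₂B − Yb₂)/|γ|²`. [this work] -/
def vth (t v : ℝ) : ℝ := (a₂ t * P.B t - P.Y t * b₂ t) / P.Dn t v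

/-- The end `(q₀+q₂t²)κ/(1−nt²)` (`Θ(t,1)` is its half). [this work] -/
def Gq (t : ℝ) : ℝ := (P.q₀ + P.q₂ * t ^ 2) * P.kq t / (1 - P.n * t ^ 2)

/-- The constant `α = q₂/(q₂ + nq₀)`. [this work] -/
def alpha : ℝ := P.q₂ / (P.q₂ + P.n * P.q₀)

/-- The constant `β = n/(q₂ + nq₀)`. [this work] -/
def beta : ℝ := P.n / (P.q₂ + P.n * P.q₀)

/-- `1 − nt² > 0` on `t² ≤ 1` (`n < 1`, any sign). [folklore] -/
theorem one_sub_n_pos {t : ℝ} (ht : t ^ 2 ≤ 1) : 0 < 1 - P.n * t ^ 2 := by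
  rcases le_or_gt 0 P.n with hn | hn
  · nlinarith [mul_le_mul_of_nonneg_left ht hn, P.n_lt]
  · nlinarith [mul_nonneg (neg_nonneg.2 hn.le) (sq_nonneg t)]

/-- **The split** `κ/(1−nt²) = ακ + 2β·(q₀+q₂t²)κ/(2(1−nt²))` (`t² ≤ 1`). [this work] -/
theorem alpha_split {t : ℝ} (ht : t ^ 2 ≤ 1) :
    P.alpha = (1 - P.beta * (P.q₀ + P.q₂ * t ^ 2)) * (1 - P.n * t ^ 2)⁻¹ := by
  have hr := P.res
  have h := (P.one_sub_n_pos ht).ne'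
  unfold alpha beta
  field_simp
  ring

/-! ### Positivity of `|γ|²` on the closed square -/

/-- Values of the homotopy at the two ends `v = 0, 1`. [this work] -/
theorem ends (t k : ℝ) : P.re t 0 = a₂ t ∧ P.im t 0 = b₂ t ∧ P.dre t 0 k = a₂' t ∧ P.dim t 0 = b₂' t ∧
    P.re t 1 = P.Y t ∧ P.im t 1 = P.B t ∧ P.dre t 1 k = P.Yd t k ∧ P.dim t 1 = P.B' t := by
  refine ⟨?_, ?_, ?_, ?_, ?_, ?_, ?_, ?_⟩ <;> simp [re, im, dre, dim]

/-- `W(0) = 1`. [folklore] -/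
theorem W_zero : soloInformedT4W P.m 0 = 1 := by
  simp [soloInformedT4W]

/-- **`|γ_v(t)|² > 0` on `[0,1]²**: the imaginary part is positive for `t > 0`, the real part
at `t = 0` is `1 − v + vC(0) > 0`. [this work] -/
theorem Dn_pos {t v : ℝ} (ht : t ∈ Icc (0:ℝ) 1) (hv : v ∈ Icc (0:ℝ) 1) : 0 < P.Dn t v := by
  unfold Dn
  rcases eq_or_lt_of_le ht.1 with h0 | h0
  · have e : P.re 0 v = (1 - v) * 1 + v * P.C 0 := by unfold re a₂ Y; rw [P.W_zero]; ring
    have ha : 0 < P.re t v := by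
      rw [← h0, e]; exact SoloInformedPellAbelCirc.convex_pos one_pos P.C_zero hv
    nlinarith [mul_self_nonneg (P.im t v), mul_pos ha ha]
  · have hb0 : 0 < b₂ t := by unfold b₂; linarith
    have hb : 0 < P.im t v := by
      unfold im; exact SoloInformedPellAbelCirc.convex_pos hb0 (P.B_pos t ⟨h0, ht.2⟩) hv
    nlinarith [mul_self_nonneg (P.re t v), mul_pos hb hb]

/-! ### The two derivative identities -/

/-- `a₂′` is the derivative of `a₂`. [folklore] -/
theorem a₂_hasDerivAt (t : ℝ) : HasDerivAt a₂ (a₂' t) t := by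
  have h := (soloInformed_hasDerivAt_sq t).const_sub 1
  refine HasDerivAt.congr_deriv (f := a₂) (by unfold a₂; exact h) ?_
  unfold a₂'
  ring

/-- `b₂′` is the derivative of `b₂`. [folklore] -/
theorem b₂_hasDerivAt (t : ℝ) : HasDerivAt b₂ (b₂' t) t := by
  have h := (hasDerivAt_id' t).const_mul 2
  refine HasDerivAt.congr_deriv (f := b₂) (by unfold b₂; exact h) ?_
  unfold b₂'
  ring

/-- `∂_t Y = Y_d(t, κ(t))` for `t² < 1`. [this work] -/
theorem Y_hasDerivAt {t : ℝ} (ht : t ^ 2 < 1) : HasDerivAt (fun t => P.Y t) (P.Yd t (P.kq t)) t := by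
  unfold Y Yd Wd kq
  exact (P.hasDerivAt_C t).mul (soloInformed_t4_W_hasDerivAt P.m_mem ht)

/-- `ω = ω_core` off the face `t = 1`. [this work] -/
theorem om_eq {t : ℝ} (ht : t < 1) (v : ℝ) : P.om t v = P.omCore t v := by
  simp [om, ht]

/-- **`∂_t ϑ = ω`** for `t ∈ [0,1)`, `v ∈ [0,1]`: closedness of the angular form. [this work] -/
theorem vth_hasDerivAt {t v : ℝ} (ht : t ∈ Ico (0:ℝ) 1) (hv : v ∈ Icc (0:ℝ) 1) :
    HasDerivAt (fun t => P.vth t v) (P.om t v) t := by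
  have ht2 : t ^ 2 < 1 := by nlinarith [ht.1, ht.2]
  have hD0 := (P.Dn_pos ⟨ht.1, ht.2.le⟩ hv).ne'
  have hY := P.Y_hasDerivAt ht2
  have hB := P.hasDerivAt_B t
  have ha : HasDerivAt (fun t => P.re t v) (P.dre t v (P.kq t)) t := by
    unfold re dre
    exact ((a₂_hasDerivAt t).const_mul (1 - v)).add (hY.const_mul v)
  have hb : HasDerivAt (fun t => P.im t v) (P.dim t v) t := by
    unfold im dim
    exact ((b₂_hasDerivAt t).const_mul (1 - v)).add (hB.const_mul v)
  have hDd : HasDerivAt (fun t => P.Dn t v) (P.dre t v (P.kq t) * P.re t v + P.re t v * P.dre t v (P.kq t) +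
      (P.dim t v * P.im t v + P.im t v * P.dim t v)) t := by
    unfold Dn
    exact (ha.mul ha).add (hb.mul hb)
  have hM : HasDerivAt (fun t => a₂ t * P.B t - P.Y t * b₂ t)
      (a₂' t * P.B t + a₂ t * P.B' t - (P.Yd t (P.kq t) * b₂ t + P.Y t * b₂' t)) t :=
    ((a₂_hasDerivAt t).mul hB).sub (hY.mul (b₂_hasDerivAt t))
  rw [P.om_eq ht.2]
  unfold vth
  refine (hM.div hDd hD0).congr_deriv ?_
  unfold omCore En Nmv Nm Dnv Dn re im dre dim
  ring

/-- **`∂_v Θ = ω`** for `t ∈ [0,1)`, `v ∈ [0,1]`. [this work] -/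
theorem Th_hasDerivAt {t v : ℝ} (ht : t ∈ Ico (0:ℝ) 1) (hv : v ∈ Icc (0:ℝ) 1) :
    HasDerivAt (fun v => P.Th t v) (P.om t v) v := by
  have hD0 := (P.Dn_pos ⟨ht.1, ht.2.le⟩ hv).ne'
  have ha : HasDerivAt (fun v => P.re t v) (P.Y t - a₂ t) v :=
    SoloInformedPellAbelCirc.hasDerivAt_affine _ _ v
  have hda : HasDerivAt (fun v => P.dre t v (P.kq t)) (P.Yd t (P.kq t) - a₂' t) v :=
    SoloInformedPellAbelCirc.hasDerivAt_affine _ _ v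
  have hb : HasDerivAt (fun v => P.im t v) (P.B t - b₂ t) v :=
    SoloInformedPellAbelCirc.hasDerivAt_affine _ _ v
  have hdb : HasDerivAt (fun v => P.dim t v) (P.B' t - b₂' t) v :=
    SoloInformedPellAbelCirc.hasDerivAt_affine _ _ v
  have hN : HasDerivAt (fun v => P.Nm t v (P.kq t)) ((P.Y t - a₂ t) * P.dim t v +
      P.re t v * (P.B' t - b₂' t) - ((P.B t - b₂ t) * P.dre t v (P.kq t) +
        P.im t v * (P.Yd t (P.kq t) - a₂' t))) v := by
    unfold Nm
    exact (ha.mul hdb).sub (hb.mul hda)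
  have hDd : HasDerivAt (fun v => P.Dn t v) ((P.Y t - a₂ t) * P.re t v + P.re t v * (P.Y t - a₂ t) +
      ((P.B t - b₂ t) * P.im t v + P.im t v * (P.B t - b₂ t))) v := by
    unfold Dn
    exact (ha.mul ha).add (hb.mul hb)
  rw [P.om_eq ht.2]
  unfold Th
  refine (hN.div hDd hD0).congr_deriv ?_
  unfold omCore En Nmv Dnv
  ring

/-! ### Boundary values -/

/-- **The faces**: `ϑ(0,v) = 0` (`B(0) = 0 = b₂(0)`), `ϑ(1,v) = 0` (`a₂(1) = 0 = W(1)`),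
`ω(1,v) = 0` (glued). [this work] -/
theorem faces (v : ℝ) : P.vth 0 v = 0 ∧ P.vth 1 v = 0 ∧ P.om 1 v = 0 := by
  have h : a₂ 1 = 0 := by unfold a₂; norm_num
  refine ⟨by simp [vth, Y, b₂, P.B_zero], by simp [vth, Y, h, soloInformed_t4_W_one], by simp [om]⟩

/-- **The model end** `Θ(t,0) = 2/(1+t²)` (`a₂b₂′ − b₂a₂′ = 2(1+t²)`, `a₂² + b₂² = (1+t²)²`).
[this work] -/
theorem Th_zero (t : ℝ) : P.Th t 0 = 2 / (1 + t ^ 2) := by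
  have h1 : P.Nm t 0 (P.kq t) = 2 * (1 + t ^ 2) := by
    unfold Nm re im dre dim a₂ b₂ a₂' b₂'; ring
  have h2 : P.Dn t 0 = (1 + t ^ 2) ^ 2 := by
    unfold Dn re im a₂ b₂; ring
  have h3 : (1 + t ^ 2) ≠ 0 := by positivity
  unfold Th
  rw [h1, h2]
  field_simp

/-- `Nm(t,1) = (q₀+q₂t²)Rκ/2`: the angular derivative of the unit. [this work] -/
theorem Nm_one (t : ℝ) : P.Nm t 1 (P.kq t) = (P.q₀ + P.q₂ * t ^ 2) * P.R t * P.kq t / 2 := by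
  have key := P.num t
  obtain ⟨-, -, -, -, ha, hb, hda, hdb⟩ := P.ends t (P.kq t)
  unfold Nm
  rw [ha, hb, hda, hdb]
  unfold Yd Y Wd kq soloInformedT4W
  linear_combination ((√(1 - t ^ 2))⁻¹ * (√(1 - P.m * t ^ 2))⁻¹ / 2) * key

/-- `|γ_1(t)|² = C²Δ + B² = R(1−nt²)` for `t² < 1`. [this work] -/
theorem Dn_one {t : ℝ} (ht : t ^ 2 < 1) : P.Dn t 1 = P.R t * (1 - P.n * t ^ 2) := by
  have hW := soloInformed_t4_W_sq P.m_mem ht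
  have hN := P.norm t
  obtain ⟨-, -, -, -, ha, hb, -, -⟩ := P.ends t 0
  unfold Dn
  rw [ha, hb, ← hN]
  unfold Y
  rw [← hW]
  ring

/-- **The unit's end** `Θ(t,1) = (q₀+q₂t²)κ/(2(1−nt²))` for `t² < 1`. [this work] -/
theorem Th_one {t : ℝ} (ht : t ^ 2 < 1) : P.Th t 1 = P.Gq t / 2 := by
  have hR := (P.R_pos t ht.le).ne'
  have h1n := (P.one_sub_n_pos ht.le).ne'
  unfold Th Gq
  rw [P.Nm_one, P.Dn_one ht]
  field_simp

/-- `C`, `B` and `W` are continuous. [folklore] -/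
theorem continuous_CBW : Continuous P.C ∧ Continuous P.B ∧ Continuous (soloInformedT4W P.m) :=
  ⟨continuous_iff_continuousAt.2 fun t => (P.hasDerivAt_C t).continuousAt,
    continuous_iff_continuousAt.2 fun t => (P.hasDerivAt_B t).continuousAt,
    SoloInformedPellAbel.W_continuous P.m⟩

/-- `(t,v) ↦ |γ_v(t)|²` is continuous. [folklore] -/
theorem continuous_Dn : Continuous fun p : ℝ × ℝ => P.Dn p.1 p.2 := by
  obtain ⟨hC, hB, hW⟩ := P.continuous_CBW
  unfold Dn re im a₂ b₂ Y
  fun_prop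

/-- **Fibrewise continuity of the potentials**: `ϑ(·,v)` and `Θ(t,·)` are continuous on `[0,1]`
(`t, v ∈ [0,1]`). [this work] -/
theorem continuousOn_potentials {t v : ℝ} (ht : t ∈ Icc (0:ℝ) 1) (hv : v ∈ Icc (0:ℝ) 1) :
    ContinuousOn (fun s => P.vth s v) (Icc 0 1) ∧ ContinuousOn (fun u => P.Th t u) (Icc 0 1) := by
  obtain ⟨hC, hB, hW⟩ := P.continuous_CBW
  have hD : Continuous fun s => P.Dn s v :=
    P.continuous_Dn.comp (continuous_id.prodMk continuous_const)
  have hD' : Continuous fun u => P.Dn t u :=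
    P.continuous_Dn.comp (continuous_const.prodMk continuous_id)
  refine ⟨?_, ?_⟩
  · unfold vth
    refine ContinuousOn.div (Continuous.continuousOn ?_) hD.continuousOn
      fun s hs => (P.Dn_pos hs hv).ne'
    unfold a₂ b₂ Y
    fun_prop
  · unfold Th
    refine ContinuousOn.div (Continuous.continuousOn ?_) hD'.continuousOn
      fun u hu => (P.Dn_pos ht hu).ne'
    unfold Nm re im dre dim
    fun_prop

end SoloInformedPellAbelQuarter

end Summit.KontsevichZagierPeriods.KontsevichZagierPeriods.Theorems

end
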